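import Literature.Analysis.FluidPDE.ForcedOseenRepresentationClassical
import Literature.Analysis.FluidPDE.NSBoundedMildSmoothing
import Literature.Analysis.FluidPDE.KNSSTypeIRateMildProofs
import HarnessLib

/-!
# The forced Oseen residual of a bounded classical finite-energy solution, pointwise and between
# any two times, and its transport under the Koch–Nadirashvili–Seregin–Šverák zoom

Analysis/FluidPDE proof file (theorems only; no definitions, no named facts). The tree's
`IsClassicalNSSolutionOn.ae_eq_forced_oseenMild` (`ForcedOseenRepresentationClassical.lean`;
Lemarié-Rieusset 2016, Thm. 6.1 / Prop. 6.5 with a force, fed with Tao 2013 Lemma 8.1 and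
Fabes–Jones–Rivière 1972 Thm. 2.1) represents a bounded classical finite-energy solution of the
Navier–Stokes system on `[0, T] × ℝ³` driven by a bounded, jointly continuous, weakly
divergence-free, square-integrable force `g` (e.g. the Leray projection of a Clay force) as
`u(t) = e^{νtΔ}u(0) − B^ν_0(u,u)(t) + ∫₀ᵗ e^{ν(t−τ)Δ} g(τ) dτ`, ALMOST EVERYWHERE in `x`, from the
base time `0`. For compactness arguments on zoomed sequences (Koch–Nadirashvili–Seregin–Šverák
2009, §6: `v^{(k)}(y, s) = M_k⁻¹ u(x_k + y/M_k, t_k + s/M_k²)`, Lemma 6.1 with a vanishing right-hand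
side — the tree's `exists_oseenMild_limit_of_forced`) one needs the OSEEN RESIDUAL
`u(t) − e^{ν(t−s)Δ}u(s) + B^ν_s(u,u)(t)` between ANY two times `0 ≤ s < t ≤ T`, at EVERY point, and
its behaviour under the zoom. This file proves:

* `IsClassicalNSSolutionOn.norm_oseenResidual_le_forced` — for all `0 ≤ s < t ≤ T` and every `x`,
  `‖u(t,x) − e^{ν(t−s)Δ}u(s)(x) + B^ν_s(u,u)(t)(x)‖ ≤ (t − s) · sup‖g‖`: the residual IS the force
  Duhamel integral a.e. (the representation from the base time `s`, by time translation,
  `IsClassicalNSSolutionOn.comp_add_right`, `oseenDuhamel_translate`), the force integral is bounded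
  by `(t − s) sup‖g‖` everywhere (`norm_forceDuhamel_le`, maximum principle of the heat flow), and the
  residual is CONTINUOUS in `x` (`contDiff_heatExtension_of_bound`, `continuous_oseenDuhamel_slice`), so
  the a.e. bound holds everywhere (`forall_norm_le_of_ae_norm_le`);
* `oseenResidual_smul_stPull` — under the zoom `w(σ, y) = c u(t₀ + c²σ, x₀ + c y)` (`ν = 1`) the
  residual of `w` between `σ < τ` at `y` is `c` times the residual of `u` between `t₀ + c²σ < t₀ + c²τ`
  at `x₀ + c y` (parabolic covariance of the caloric and Duhamel terms, the tree's
  `heatExtension_smul_stPull`, `oseenDuhamel_smul_stPull`; KNSS 2009 §1 (1.2)), hence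
  `norm_oseenResidual_smul_stPull_le`: a residual bound `(t − s) G` for `u` becomes `c³ (τ − σ) G` for
  `w` — the force DISAPPEARS from the zoomed Oseen equation at rate `c³ = M⁻³`.

Consumers: the forced zoom of the cell `ns-blowup`'s E–C endpoint type
(`Summits/NavierStokesRegularity/FluidComputer/ClayBlowupZoom.lean`). WHAT THIS IS NOT: no statement
about the existence of solutions; bounds for GIVEN bounded classical solutions of the forced system.

## References

* G. Koch, N. Nadirashvili, G. Seregin, V. Šverák, *Liouville theorems for the Navier–Stokes
  equations and applications*, Acta Math. 203 (2009) 83–105 = arXiv:0709.3599: §1 (1.2), §3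
  (3.4)–(3.8), §6 (6.2)–(6.3), Lemma 6.1. [KochNadirashviliSereginSverak2009]
* P. G. Lemarié-Rieusset, *The Navier–Stokes Problem in the 21st Century*, CRC Press (2016),
  Thm. 6.1 with Prop. 6.5 (pp. 133–136). [LemarieRieusset2016]
-/

noncomputable section

open MeasureTheory TopologicalSpace Set Function Filter
open _root_.Topology
open scoped InnerProductSpace RealInnerProductSpace ENNReal NNReal

namespace Literature.Analysis.FluidPDE

/-! ### The residual between any two times, pointwise -/

section Residual

variable {ν T M G : ℝ} {g u : ℝ → EuclideanSpace ℝ (Fin 3) → EuclideanSpace ℝ (Fin 3)}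
  {p : ℝ → EuclideanSpace ℝ (Fin 3) → ℝ}

/-- **The forced Oseen residual between any two times, at every point.** Let `(u, p)` be a classical
solution of the Navier–Stokes system (`ν > 0`) on `[0, T] × ℝ³` driven by a jointly continuous force
`g` with `‖g‖ ≤ G`, weakly divergence-free slices and `‖g(τ)‖_{L²} ≤ G₂ < ∞`, with finite energy and
`‖u‖ ≤ M` on the slab. Then for all `0 ≤ s < t ≤ T` and EVERY `x`,
`‖u(t, x) − e^{ν(t−s)Δ}u(s)(x) + B^ν_s(u, u)(t)(x)‖ ≤ (t − s) G`: a.e. in `x` the residual equals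
`∫ₛᵗ e^{ν(t−τ)Δ} g(τ) dτ` (the forced Oseen representation from the base time `s`, Lemarié-Rieusset
2016 Thm. 6.1 with force, by time translation), whose norm is at most `(t − s) G`; the residual is
continuous in `x`, so the bound holds everywhere.
[cite: LemarieRieusset2016, Thm. 6.1 with Prop. 6.5 (pp. 133–136)] -/
theorem IsClassicalNSSolutionOn.norm_oseenResidual_le_forced
    (hcl : IsClassicalNSSolutionOn (Icc 0 T) ν g u p) (hν : 0 < ν)
    (hgc : Continuous (uncurry g)) (hG : ∀ τ ∈ Icc 0 T, ∀ y, ‖g τ y‖ ≤ G)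
    (hgdiv : ∀ τ ∈ Icc 0 T, IsWeaklyDivFree (g τ)) {G₂ : ℝ≥0∞} (hG₂ : G₂ ≠ ⊤)
    (hg2 : ∀ τ ∈ Icc 0 T, eLpNorm (g τ) 2 volume ≤ G₂)
    (hE : ∃ C : ℝ≥0∞, C < ⊤ ∧ ∀ t ∈ Icc 0 T, ∫⁻ x, ‖u t x‖ₑ ^ 2 ≤ C)
    (hM : 0 < M) (hbd : ∀ t ∈ Icc 0 T, ∀ y, ‖u t y‖ ≤ M)
    {s t : ℝ} (hs : 0 ≤ s) (hst : s < t) (htT : t ≤ T) (x : EuclideanSpace ℝ (Fin 3)) :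
    ‖u t x - UnboundedOperators.heatExtension (u s) (ν * (t - s)) x + oseenDuhamel ν s u u t x‖ ≤
      (t - s) * G := by
  have hts : 0 < t - s := sub_pos.2 hst
  -- ### the time-translated solution on `[0, t - s]`
  have hsubI : ∀ τ ∈ Icc 0 (t - s), τ + s ∈ Icc 0 T := fun τ hτ =>
    ⟨by linarith [hτ.1], by linarith [hτ.2]⟩
  have hcl' : IsClassicalNSSolutionOn (Icc 0 (t - s)) ν (fun τ => g (τ + s)) (fun τ => u (τ + s))
      (fun τ => p (τ + s)) :=
    (hcl.comp_add_right s).mono (fun τ hτ => hsubI τ hτ) (uniqueDiffOn_Icc hts)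
  have hgc' : Continuous (uncurry fun τ => g (τ + s)) :=
    hgc.comp ((continuous_fst.add continuous_const).prodMk continuous_snd)
  have hG' : ∀ τ ∈ Icc 0 (t - s), ∀ y, ‖(fun τ => g (τ + s)) τ y‖ ≤ G := fun τ hτ y =>
    hG (τ + s) (hsubI τ hτ) y
  have hgdiv' : ∀ τ ∈ Icc 0 (t - s), IsWeaklyDivFree ((fun τ => g (τ + s)) τ) := fun τ hτ =>
    hgdiv (τ + s) (hsubI τ hτ)
  have hg2' : ∀ τ ∈ Icc 0 (t - s), eLpNorm ((fun τ => g (τ + s)) τ) 2 volume ≤ G₂ := fun τ hτ =>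
    hg2 (τ + s) (hsubI τ hτ)
  have hE' : ∃ C : ℝ≥0∞, C < ⊤ ∧ ∀ τ ∈ Icc 0 (t - s), ∫⁻ y, ‖(fun τ => u (τ + s)) τ y‖ₑ ^ 2 ≤ C := by
    obtain ⟨C, hC, hb⟩ := hE
    exact ⟨C, hC, fun τ hτ => hb (τ + s) (hsubI τ hτ)⟩
  have hbd' : ∀ τ ∈ Icc 0 (t - s), ∀ y, ‖(fun τ => u (τ + s)) τ y‖ ≤ M := fun τ hτ y =>
    hbd (τ + s) (hsubI τ hτ) y
  -- ### the representation from the base time `s`, a.e.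
  have hrep := hcl'.ae_eq_forced_oseenMild hν hts hgc' hG' hgdiv' hG₂ hg2' hE' hM hbd'
    (t := t - s) ⟨hts, le_rfl⟩
  have e3 : ∀ y, oseenDuhamel ν 0 (fun τ => u (τ + s)) (fun τ => u (τ + s)) (t - s) y =
      oseenDuhamel ν s u u t y := fun y => by
    rw [oseenDuhamel_translate ν 0 s u u (t - s) y, zero_add, sub_add_cancel]
  rw [sub_add_cancel, zero_add] at hrep
  -- ### the force integral is bounded by `(t - s) G` everywhere
  have hF : ∀ y, ‖forceDuhamel ν 0 (fun τ => g (τ + s)) (t - s) y‖ ≤ (t - s) * G := by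
    intro y
    have h := norm_forceDuhamel_le (ν := ν) (s := 0) (t := t - s) (g := fun τ => g (τ + s)) (G := G)
      hν hts.le (fun τ hτ z => hG (τ + s) ⟨by linarith [hτ.1], by linarith [hτ.2]⟩ z) y
    rwa [sub_zero] at h
  have hae : ∀ᵐ y ∂(volume : Measure (EuclideanSpace ℝ (Fin 3))),
      ‖u t y - UnboundedOperators.heatExtension (u s) (ν * (t - s)) y + oseenDuhamel ν s u u t y‖ ≤
        (t - s) * G := by
    filter_upwards [hrep] with y hy
    rw [hy, ← e3 y]
    have : UnboundedOperators.heatExtension (u s) (ν * (t - s)) y -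
          oseenDuhamel ν 0 (fun τ => u (τ + s)) (fun τ => u (τ + s)) (t - s) y +
          forceDuhamel ν 0 (fun τ => g (τ + s)) (t - s) y -
        UnboundedOperators.heatExtension (u s) (ν * (t - s)) y +
        oseenDuhamel ν 0 (fun τ => u (τ + s)) (fun τ => u (τ + s)) (t - s) y =
        forceDuhamel ν 0 (fun τ => g (τ + s)) (t - s) y := by abel
    rw [this]
    exact hF y
  -- ### the residual is continuous in `x`
  have htI : t ∈ Icc 0 T := ⟨hs.trans hst.le, htT⟩
  have hsI : s ∈ Icc 0 T := ⟨hs, hst.le.trans htT⟩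
  have hcu : ∀ τ ∈ Icc 0 T, Continuous (u τ) := fun τ hτ => (hcl.contDiff_velocity hτ).continuous
  have hheat : Continuous (UnboundedOperators.heatExtension (u s) (ν * (t - s))) :=
    (UnboundedOperators.contDiff_heatExtension_of_bound (m := 0) (hcu s hsI) (fun z => hbd s hsI z)
      (mul_pos hν hts)).continuous
  have hmeas : AEStronglyMeasurable (uncurry u)
      ((volume : Measure (ℝ × EuclideanSpace ℝ (Fin 3))).restrict (Ioo s t ×ˢ univ)) := by
    have hsub : Ioo s t ×ˢ (univ : Set (EuclideanSpace ℝ (Fin 3))) ⊆ Icc 0 T ×ˢ univ :=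
      prod_mono (fun τ hτ => ⟨hs.trans hτ.1.le, hτ.2.le.trans htT⟩) subset_rfl
    exact (hcl.smooth_velocity.continuousOn.mono hsub).aestronglyMeasurable
      (measurableSet_Ioo.prod MeasurableSet.univ)
  have hbdo : ∀ τ ∈ Ioo s t, ∀ y, ‖u τ y‖ ≤ M := fun τ hτ y =>
    hbd τ ⟨hs.trans hτ.1.le, hτ.2.le.trans htT⟩ y
  have hB : Continuous (oseenDuhamel ν s u u t) :=
    continuous_oseenDuhamel_slice hν hM.le hmeas hmeas hbdo hbdo hst le_rfl
  have hcont : Continuous fun y =>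
      u t y - UnboundedOperators.heatExtension (u s) (ν * (t - s)) y + oseenDuhamel ν s u u t y :=
    ((hcu t htI).sub hheat).add hB
  exact forall_norm_le_of_ae_norm_le hcont hae x

end Residual

/-! ### Transport of the residual under the zoom `w(σ, y) = c u(t₀ + c²σ, x₀ + c y)` -/

section Zoom

variable {E : Type*} [NormedAddCommGroup E] [InnerProductSpace ℝ E] [FiniteDimensional ℝ E]
  [MeasurableSpace E] [BorelSpace E]

/-- **The Oseen residual of the zoomed field** (`ν = 1`; KNSS 2009, §1 (1.2) and §6 (6.2)): for
`w = c • stPull (c²) c t₀ x₀ u`, i.e. `w(σ, y) = c u(t₀ + c²σ, x₀ + c y)`, `c > 0` and `σ < τ`,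
`w(τ, y) − e^{(τ−σ)Δ}w(σ)(y) + B¹_σ(w, w)(τ)(y) = c · (u(t') − e^{(t'−s')Δ}u(s') + B¹_{s'}(u, u)(t'))(x₀ + c y)`
with `s' = t₀ + c²σ`, `t' = t₀ + c²τ` (parabolic covariance of the caloric term,
`heatExtension_smul_stPull`, and of the Duhamel term, `oseenDuhamel_smul_stPull`).
[cite: KochNadirashviliSereginSverak2009, §1 (1.2) and §6 (6.2) (arXiv pp. 2, 11)] -/
theorem oseenResidual_smul_stPull {c : ℝ} (hc : 0 < c) (t₀ : ℝ) (x₀ : E) (u : ℝ → E → E)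
    {σ τ : ℝ} (hστ : σ < τ) (y : E) :
    (c • stPull (c ^ 2) c t₀ x₀ u) τ y -
        UnboundedOperators.heatExtension ((c • stPull (c ^ 2) c t₀ x₀ u) σ) (τ - σ) y +
        oseenDuhamel 1 σ (c • stPull (c ^ 2) c t₀ x₀ u) (c • stPull (c ^ 2) c t₀ x₀ u) τ y =
      c • (u (t₀ + c ^ 2 * τ) (x₀ + c • y) -
        UnboundedOperators.heatExtension (u (t₀ + c ^ 2 * σ))
          (1 * (t₀ + c ^ 2 * τ - (t₀ + c ^ 2 * σ))) (x₀ + c • y) +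
        oseenDuhamel 1 (t₀ + c ^ 2 * σ) u u (t₀ + c ^ 2 * τ) (x₀ + c • y)) := by
  have hT : 0 < τ - σ := sub_pos.2 hστ
  have e : 1 * (t₀ + c ^ 2 * τ - (t₀ + c ^ 2 * σ)) = c ^ 2 * (τ - σ) := by ring
  rw [smul_stPull_apply, heatExtension_smul_stPull hc t₀ x₀ u σ hT y,
    oseenDuhamel_smul_stPull hc t₀ x₀ u hστ.le y, e, smul_add, smul_sub]

/-- **The residual bound passes to the zoomed field with the factor `c³`**: if the residual of `u`
between `s' = t₀ + c²σ` and `t' = t₀ + c²τ` is bounded by `(t' − s') G` at the point `x₀ + c y`, then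
the residual of `w = c • stPull (c²) c t₀ x₀ u` between `σ < τ` at `y` is bounded by
`c³ (τ − σ) G` — the zoomed equation is Oseen-mild up to an error that vanishes like `M⁻³`,
`M = c⁻¹` the magnitude zoomed in on (KNSS 2009, §6, (6.2)–(6.3) with a force).
[cite: KochNadirashviliSereginSverak2009, §6 (6.2)–(6.3) (arXiv p. 11)] -/
theorem norm_oseenResidual_smul_stPull_le {c : ℝ} (hc : 0 < c) (t₀ : ℝ) (x₀ : E) (u : ℝ → E → E)
    {σ τ G : ℝ} (hστ : σ < τ) (y : E)
    (hres : ‖u (t₀ + c ^ 2 * τ) (x₀ + c • y) -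
        UnboundedOperators.heatExtension (u (t₀ + c ^ 2 * σ))
          (1 * (t₀ + c ^ 2 * τ - (t₀ + c ^ 2 * σ))) (x₀ + c • y) +
        oseenDuhamel 1 (t₀ + c ^ 2 * σ) u u (t₀ + c ^ 2 * τ) (x₀ + c • y)‖ ≤
        (t₀ + c ^ 2 * τ - (t₀ + c ^ 2 * σ)) * G) :
    ‖(c • stPull (c ^ 2) c t₀ x₀ u) τ y -
        UnboundedOperators.heatExtension ((c • stPull (c ^ 2) c t₀ x₀ u) σ) (τ - σ) y +
        oseenDuhamel 1 σ (c • stPull (c ^ 2) c t₀ x₀ u) (c • stPull (c ^ 2) c t₀ x₀ u) τ y‖ ≤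
      c ^ 3 * (τ - σ) * G := by
  rw [oseenResidual_smul_stPull hc t₀ x₀ u hστ y, norm_smul, Real.norm_eq_abs, abs_of_pos hc]
  calc c * _ ≤ c * ((t₀ + c ^ 2 * τ - (t₀ + c ^ 2 * σ)) * G) := mul_le_mul_of_nonneg_left hres hc.le
    _ = c ^ 3 * (τ - σ) * G := by ring

end Zoom

end Literature.Analysis.FluidPDE

end
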